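import Summits.QuantumFields.YangMills.Theorems.BalabanUVNodesN07ChartDDerivative
import Summits.QuantumFields.YangMills.Theorems.BalabanUVNodesN07ChartDOfRecord
import Summits.QuantumFields.YangMills.Theorems.BalabanUVNodesK0FlatPortBodyP
import HarnessLib

/-!
# BalabanUVNodes ∕ N07 — [15] PROPOSITION 3 FOR THE TRUE MULTI-LEVEL (0.4)-CONSTRAINT AT NODE 00's RECORD, WITH NO DISPLAYED OPERATOR LETTER: the whole package
# (45)∕(46) `H`, (47)–(49) `D(·)`, (55), (57), (59)–(62) (the chart is onto), (73), holomorphy — for every `T4Family`, every (2.2)-admissible nested family of cubes at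
# the thresholds of lit-balaban's Cor. 2.8 (dag k0-s1-w3's `K0FlatPortBodyP.body_of_adm22_T4`), every level-weight family, every `ε` in the explicit window

Cell `pub-ymgap`, width seat `pub-ymgap-dag-n07-w2` generation 3 (HUMAN RULING D-0149; DAG node N07 = [15] = [Balaban1985Variational]; W-SEAT START LIST §n07 item 2 = S2
«[15] Sect. C (47)–(49), Prop. 3 AT OBJECTS»).  `--kind proof --supports stmt-QuantumFields-20542 --as helper` (K1⁷; count-neutral).  A THREE-LANE COMPOSITION BY NAME,
nothing modified: dag k0-s1-w3's `K0FlatPortBodyP.body_of_adm22_T4` (the canonical `H = GQ*(QGQ*)⁻¹` with `IsFlatH` and the guarded (46) letter `HSupLetterG`, from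
lit-balaban [Balaban1984PropagatorsII] Cor. 2.8 at the record) → dag k0-s1-w1's `K0Stub1RecordAveragingRightInverse.exists_rightInverse_chartLog_of_flatH` (its
complexification is a right inverse of the TRUE linearisation `D(chartLog η D)(0)` with the weighted letter `B₀(1+2ℓ)(1+2ℓ+2ℓL)`) → this seat's
`N07ChartDDerivative.exists_chartD_hasFDerivAt` ((47)–(49), (55), (73), holomorphy), `N07ChartDOfRecord.size_chartA_le` ((57)) and
`N07ChartDOfRecord.chartRange_of_rightInverse` ((59)–(62)).

THE PRINT ([15] p. 289): «PROPOSITION 3. The transformation (47) … is defined and analytic for A′ satisfying (43) with ε₃ sufficiently small … its image contains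
the set of A satisfying (43) with ε₃∕2 instead of ε₃.  The function D(A′) satisfies the bound (55), and its functional derivative the bound (73)»; p. 285 «H is the
operator (45) … |H(b,y)| ≤ B₀(Lʲη)⁻¹e^{−δ₀d(b,y)} (46)» — here `H` is no longer a hypothesis: it is PRODUCED, for the record's objects, by the two k0 lanes' theorems.

WHAT IS PROVED (sorry-free; no definition; axioms standard).
* §1 ★★★ `exists_prop3Package_of_flatH` — generic carrier `P`: from `IsFlatH P k D H₀` + `HSupLetterG P k D w H₀ B₀` (`B₀ ≥ 0`) alone (with `Adm22 D R′ M`, `2L ≤ R′`,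
  `1 ≤ M`, `IsLevWeight`, and `ε > 0`, `18C₂B₀′ε ≤ 1`, `64ε ≤ R⋆`, `B₀′ := B₀(1+2ℓ)(1+2ℓ+2ℓL)`): `∃ H Dfun`, `D(chartLog)(0) ∘ H = id` **and the weighted (46) letter of `H`
  with constant `B₀′`**; `DifferentiableOn ℂ Dfun` on the weighted `ε`-ball; for every `A′` in the ball (55), (49), (48), `∃ 𝔇, HasFDerivAt Dfun 𝔇 A′` with (73), **and
  (57)** `w₁(b)‖(A′ − H·Dfun A′)(b)‖ ≤ ρ + B₀′·4C₂ρ²`; **and (59)–(62): every `A` of weighted size `< ε∕2` is `A′ − H·Dfun A′` for `A′ := A + H·C(A)` in the ball, with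
  `Dfun A′ = C(A)`** (`C := chartLog − D(chartLog)(0)`).
* §2 ★★★★ `exists_prop3_T4` — THE RECORD EDITION: for every `F : T4Family` there are thresholds `Mh₀, R₀` and a constant `B ≥ 0` such that for all `n, K` (`1 ≤ K − n`,
  `K − n + 1 ≤ m + K`), `Mh = L^{a′} ≥ Mh₀`, `R ≥ R₀`, `2L ≤ R`, `a′ + 3 ≤ m + n`, every nested family `D : Domains (F.P K)` with `D.k = K − n` and `Adm22 D R (L·Mh)`, every
  `w` with `IsLevWeight (F.P K) (K − n) D w`, and every `ε > 0` with `18C₂Bε ≤ 1`, `64ε ≤ R⋆`: the full package of §1 with letter constant `B` — NO operator hypothesis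
  (binders = those of `body_of_adm22_T4` verbatim + `2L ≤ R` + the `ε`-window).  ★★ `exists_prop3_T4_uniform` — the same with ONE `ε > 0` chosen uniformly in `n, K, D, w`
  («ε₃ sufficiently small», independent of `k`: A6 for the window, by `N07ChartDDerivative.exists_eps_chartDDeriv`).

HONEST FRAMING: composition of kernel theorems by name; (73) at norm level (no kernel decay: `B11Eq73KernelDecay` not connected); (58) not here; the fibre is
`M_n(ℂ)` (the 𝔰𝔲(N)-valued refinement of `H` is k0-s1-w1's `exists_suRightInverse_linFamily`, not threaded); nothing of [15] Sects. D–F asserted; stub 1 ∕ K0⁷ ∕ K1⁷ NOT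
closed; N07 NOT discharged; counts unmoved (5∕27); one finite T⁴ programme at fixed ε — NOT continuum ∕ ℝ⁴ ∕ OS ∕ mass gap ∕ Clay: the Yang–Mills mass gap is NOT proved
by any of this; R4 closes the conditional rung `BalabanLadder.UV` only.  No `sorry`, no `def`, no `instance`, no `notation`.

References: [15] T. Bałaban, CMP 102 (1985) 277–309 [Balaban1985Variational] ((43)–(62) pp.285–287, (70)–(73) p.289, Prop. 3 p.289, (156)–(157) p.302); T. Bałaban,
CMP 96 (1984) 223–250 [Balaban1984PropagatorsII] (Prop. 2.6 p.247, Cor. 2.8 p.249); [I] CMP 109 (1987) 249–301 [Balaban1987RG1] ((0.1) p.251, (0.4) p.253).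
-/

noncomputable section

open scoped BigOperators Matrix.Norms.L2Operator
open NormedSpace Metric Set

namespace Summit.QuantumFields.YangMills.BalabanUVNodes.N07Prop3AtRecord

open Literature.MathematicalPhysics.QuantumFieldTheory.Balaban1983to89
open Literature.MathematicalPhysics.QuantumFieldTheory.Balaban1983to89.T4Continuum (T4Family)
open Literature.MathematicalPhysics.QuantumFieldTheory.Balaban1983to89.B6SectADomainsV1 (Domains)
open Literature.MathematicalPhysics.QuantumFieldTheory.Balaban1983to89.B6SectAOperatorsV1 (BondIdx)
open Summit.QuantumFields.YangMills.Theorems.FlatCubeOpsText (Adm22)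
open Summit.QuantumFields.YangMills.Theorems.K0FlatCubeOpsTextP (IsLevWeight IsFlatH HSupLetterG hSupLetterG_mono)
open Summit.QuantumFields.YangMills.Theorems.K0FlatPortBodyP (body_of_adm22_T4)
open Summit.QuantumFields.YangMills.Theorems.K0Stub1RecordAveragingRightInverse (exists_rightInverse_chartLog_of_flatH)
open Summit.QuantumFields.YangMills.Theorems.Prop8Chart (chartLog)
open Summit.QuantumFields.YangMills.BalabanUVNodes.N07ChartDOfRecord (size_chartA_le chartRange_of_rightInverse)
open Summit.QuantumFields.YangMills.BalabanUVNodes.N07ChartDDerivative (exists_chartD_hasFDerivAt exists_eps_chartDDeriv)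

variable {P : Params} {ι : Type*} [Fintype ι] [DecidableEq ι] [Nonempty ι]

/-! ## §1 The package at a generic carrier, from the flat letters `IsFlatH` ∕ `HSupLetterG` alone -/

/-- ★★★ **[15] PROPOSITION 3 — THE WHOLE PACKAGE FROM THE FLAT LETTERS OF `H₀`.**  For a torus `P`, height `k`, a (2.2)-admissible nested family `D` (`Adm22 D R′ M`,
`2L ≤ R′`, `1 ≤ M`, `D.k = k`), level weights `w`, a real operator `H₀` with `IsFlatH P k D H₀` and the guarded (46) letter `HSupLetterG P k D w H₀ B₀` (`B₀ ≥ 0`), and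
`ε > 0` with `18C₂B₀′ε ≤ 1`, `64ε ≤ R⋆` (`B₀′ = B₀(1+2ℓ)(1+2ℓ+2ℓL)`, `ℓ = (d+2)L`, `R⋆ = 1∕(12800ℓ²L)`, `C₂ = 960ℓL∕R⋆`, `C₃ = 3840ℓL∕R⋆`): there are a ℂ-linear `H` and a
map `Dfun` with — (45) `D(chartLog η D)(0)(HX) = X`; (46) `w₁(b)‖HX(b)‖ ≤ B₀′‖X‖_∞`; `Dfun` ℂ-differentiable on the weighted `ε`-ball; for every `A′` in the ball: (55),
(49), (48), `∃ 𝔇, HasFDerivAt Dfun 𝔇 A′ ∧` (73) `‖𝔇W i‖ ≤ 4C₃ε·t`; (57) `w₁(b)‖(A′ − H·Dfun A′)(b)‖ ≤ ρ + B₀′·4C₂ρ²`; and (59)–(62): every `A` of weighted size `< ε∕2`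
equals `A′ − H·Dfun A′` for `A′ := A + H·C(A)` in the ball, `Dfun A′ = C(A)`.
[cite: Balaban1985Variational, (45)-(49) p.285, (55) (57) p.286, (59)-(62) p.287, (73) p.289, Prop. 3 p.289; Balaban1984PropagatorsII, Cor. 2.8 p.249] -/
theorem exists_prop3Package_of_flatH (k : ℕ) {R' M : ℕ} (hR'L : 2 * P.L ≤ R') (hM : 1 ≤ M) (D : Domains P) (hDk : D.k = k) (hAdm : Adm22 D R' M)
    {w : ℕ → PBond P 0 → ℝ} (hw : IsLevWeight P k D w) (H₀ : (BondIdx D → ℝ) →ₗ[ℝ] (PBond P 0 → ℝ)) (hH₀ : IsFlatH P k D H₀)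
    {B₀ : ℝ} (hB₀ : 0 ≤ B₀) (hsup : HSupLetterG P k D w H₀ B₀) {ε : ℝ} (hε : 0 < ε)
    (h18 : 18 * (960 * (((P.d + 2) * P.L : ℕ) : ℝ) * (P.L : ℝ) / (12800 * (((P.d + 2) * P.L : ℕ) : ℝ) ^ 2 * (P.L : ℝ))⁻¹) *
      (B₀ * ((1 + 2 * ((P.d + 2) * P.L : ℕ)) * (1 + 2 * ((P.d + 2) * P.L : ℕ) + 2 * ((P.d + 2) * P.L : ℕ) * P.L))) * ε ≤ 1)
    (h2 : 64 * ε ≤ (12800 * (((P.d + 2) * P.L : ℕ) : ℝ) ^ 2 * (P.L : ℝ))⁻¹) :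
    let η : ℝ := ((P.L : ℝ)⁻¹) ^ k
    let Rs : ℝ := (12800 * (((P.d + 2) * P.L : ℕ) : ℝ) ^ 2 * (P.L : ℝ))⁻¹
    let C₂ : ℝ := 960 * (((P.d + 2) * P.L : ℕ) : ℝ) * (P.L : ℝ) / Rs
    let C₃ : ℝ := 3840 * (((P.d + 2) * P.L : ℕ) : ℝ) * (P.L : ℝ) / Rs
    let B₀' : ℝ := B₀ * ((1 + 2 * ((P.d + 2) * P.L : ℕ)) * (1 + 2 * ((P.d + 2) * P.L : ℕ) + 2 * ((P.d + 2) * P.L : ℕ) * P.L))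
    let Qlin := (fderiv ℂ (chartLog η D : (PBond P 0 → Matrix ι ι ℂ) → BondIdx D → Matrix ι ι ℂ) 0)
    ∃ (H : (BondIdx D → Matrix ι ι ℂ) →ₗ[ℂ] (PBond P 0 → Matrix ι ι ℂ)) (Dfun : (PBond P 0 → Matrix ι ι ℂ) → (BondIdx D → Matrix ι ι ℂ)),
      (∀ X, Qlin (H X) = X) ∧
      (∀ (X : BondIdx D → Matrix ι ι ℂ) (t : ℝ), 0 ≤ t → (∀ i, ‖X i‖ ≤ t) → ∀ b, w 1 b * ‖H X b‖ ≤ B₀' * t) ∧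
      DifferentiableOn ℂ Dfun {A' : PBond P 0 → Matrix ι ι ℂ | ∀ b, w 1 b * ‖A' b‖ < ε} ∧
      (∀ A' : PBond P 0 → Matrix ι ι ℂ, (∀ b, w 1 b * ‖A' b‖ < ε) →
        (∀ (ρ : ℝ), 0 ≤ ρ → (∀ b, w 1 b * ‖A' b‖ ≤ ρ) → ∀ i, ‖Dfun A' i‖ ≤ 4 * C₂ * ρ ^ 2) ∧
        chartLog η D (A' - H (Dfun A')) - Qlin (A' - H (Dfun A')) = Dfun A' ∧
        chartLog η D (A' - H (Dfun A')) = Qlin A' ∧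
        (∃ 𝔇 : (PBond P 0 → Matrix ι ι ℂ) →L[ℂ] (BondIdx D → Matrix ι ι ℂ), HasFDerivAt Dfun 𝔇 A' ∧
          ∀ (W : PBond P 0 → Matrix ι ι ℂ) (t : ℝ), 0 ≤ t → (∀ b, w 1 b * ‖W b‖ ≤ t) → ∀ i, ‖𝔇 W i‖ ≤ 4 * C₃ * ε * t) ∧
        (∀ (ρ : ℝ), 0 ≤ ρ → (∀ b, w 1 b * ‖A' b‖ ≤ ρ) → ∀ b, w 1 b * ‖(A' - H (Dfun A')) b‖ ≤ ρ + B₀' * (4 * C₂ * ρ ^ 2))) ∧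
      (∀ A : PBond P 0 → Matrix ι ι ℂ, (∀ b, w 1 b * ‖A b‖ < ε / 2) →
        (∀ b, w 1 b * ‖(A + H (chartLog η D A - Qlin A)) b‖ < ε) ∧
        Dfun (A + H (chartLog η D A - Qlin A)) = chartLog η D A - Qlin A ∧
        (A + H (chartLog η D A - Qlin A)) - H (Dfun (A + H (chartLog η D A - Qlin A))) = A) := by
  intro η Rs C₂ C₃ B₀' Qlin
  -- positivity of the letters
  have hL0 : (0 : ℝ) < P.L := by exact_mod_cast P.L_pos
  have hden : 0 < 12800 * (((P.d + 2) * P.L : ℕ) : ℝ) ^ 2 * (P.L : ℝ) := by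
    have : (1 : ℝ) ≤ (((P.d + 2) * P.L : ℕ) : ℝ) := by
      exact_mod_cast Nat.one_le_iff_ne_zero.mpr (Nat.mul_ne_zero (by omega) (by have := P.hL.2; omega))
    positivity
  have hRs0 : 0 < Rs := inv_pos.mpr hden
  have hC₂ : 0 ≤ C₂ := by show 0 ≤ 960 * (((P.d + 2) * P.L : ℕ) : ℝ) * (P.L : ℝ) / Rs; positivity
  have hB₀' : 0 ≤ B₀' := by
    show 0 ≤ B₀ * ((1 + 2 * ((P.d + 2) * P.L : ℕ)) * (1 + 2 * ((P.d + 2) * P.L : ℕ) + 2 * ((P.d + 2) * P.L : ℕ) * P.L)); positivity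
  have hwpos : ∀ b, 0 < w 1 b := fun b => by rw [hw 1 b, pow_one]; positivity
  -- (45)/(46): the right inverse of the true linearisation (dag k0-s1-w1)
  have hRM : 2 * P.L ≤ R' * M + 1 := by have : R' ≤ R' * M := Nat.le_mul_of_pos_right R' hM; omega
  obtain ⟨H, hHinv, hHB⟩ := exists_rightInverse_chartLog_of_flatH (n := ι) k D hDk hAdm hRM w hw H₀ hH₀ hB₀ hsup
  -- (47)–(49), (55), (73), holomorphy
  obtain ⟨Dfun, hdiff, hDfun⟩ := exists_chartD_hasFDerivAt k hR'L hM D hDk hAdm hw H hHinv hB₀' hHB hε h18 h2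
  refine ⟨H, Dfun, hHinv, hHB, hdiff, fun A' hA' => ?_, fun A hA => ?_⟩
  · obtain ⟨h55, h49, h48, h73⟩ := hDfun A' hA'
    refine ⟨h55, h49, h48, h73, fun ρ hρ hA'ρ => ?_⟩
    -- (57)
    exact size_chartA_le hwpos H hC₂ hB₀' hHB hA'ρ (h55 ρ hρ hA'ρ)
  · -- (59)–(62): the windows of `chartRange_of_rightInverse` from the present ones, with `δ := ε / 2`
    have hq : 9 * (960 * (((P.d + 2) * P.L : ℕ) : ℝ) * (P.L : ℝ) / (12800 * (((P.d + 2) * P.L : ℕ) : ℝ) ^ 2 * (P.L : ℝ))⁻¹) * B₀' * ε < 1 := by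
      have : 0 ≤ (960 * (((P.d + 2) * P.L : ℕ) : ℝ) * (P.L : ℝ) / (12800 * (((P.d + 2) * P.L : ℕ) : ℝ) ^ 2 * (P.L : ℝ))⁻¹) * B₀' * ε := by
        positivity
      nlinarith
    have h3 : 3 * ε ≤ (12800 * (((P.d + 2) * P.L : ℕ) : ℝ) ^ 2 * (P.L : ℝ))⁻¹ / 4 := by
      change 64 * ε ≤ Rs at h2
      show 3 * ε ≤ Rs / 4
      linarith
    have hδ : ε / 2 + B₀' * ((960 * (((P.d + 2) * P.L : ℕ) : ℝ) * (P.L : ℝ) / (12800 * (((P.d + 2) * P.L : ℕ) : ℝ) ^ 2 * (P.L : ℝ))⁻¹) *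
        (ε / 2) ^ 2) ≤ ε := by
      change 18 * C₂ * B₀' * ε ≤ 1 at h18
      show ε / 2 + B₀' * (C₂ * (ε / 2) ^ 2) ≤ ε
      have h1 : B₀' * (C₂ * (ε / 2) ^ 2) = (18 * C₂ * B₀' * ε) * (ε / 72) := by ring
      rw [h1]
      nlinarith
    obtain ⟨hball, hCε, -, huniq, hpre⟩ :=
      chartRange_of_rightInverse k hR'L hM D hDk hAdm hw H hB₀' hHB hq h3 (half_pos hε) (half_le_self hε.le) hδ A hA
    -- the `D` of the preimage point is `C(A)`, by uniqueness in the ball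
    obtain ⟨h55, h49, -, -⟩ := hDfun _ hball
    have hDeq : Dfun (A + H (chartLog η D A - Qlin A)) = chartLog η D A - Qlin A :=
      huniq _ (h55 ε hε.le fun b => (hball b).le) h49
    exact ⟨hball, hDeq, by rw [hDeq]; exact hpre⟩

/-! ## §2 The record edition: NODE 00's T⁴ families, no operator hypothesis -/

/-- ★★★★ **[15] PROPOSITION 3 AT NODE 00's RECORD — NO DISPLAYED OPERATOR LETTER.**  For every `F : T4Family` there are thresholds `Mh₀, R₀ : ℕ` and a constant
`B ≥ 0` (uniform in `n, K`) such that: for all `n, K` with `1 ≤ K − n`, `K − n + 1 ≤ m + K`, every `Mh = L^{a′} ≥ Mh₀`, `R ≥ R₀` with `2L ≤ R`, `a′ + 3 ≤ m + n`, every nested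
family `D : Domains (F.P K)` with `D.k = K − n`, (2.2)-admissible `Adm22 D R (L·Mh)`, every `w` with `IsLevWeight (F.P K) (K − n) D w`, and every `ε > 0` with `18C₂Bε ≤ 1`,
`64ε ≤ R⋆`: the whole package of `exists_prop3Package_of_flatH` — a ℂ-linear right inverse `H` of `D(chartLog η D)(0)` (`η = L^{−(K−n)}`) with the weighted (46) letter `B`,
the map `Dfun` ℂ-differentiable on the weighted `ε`-ball with (55), (49), (48), `HasFDerivAt` + (73), (57), and the range statement (59)–(62).  The operator is the
canonical `H = GQ*(QGQ*)⁻¹` of lit-balaban's Cor. 2.8 at the record (`K0FlatPortBodyP.body_of_adm22_T4`: `IsFlatH`, `HSupLetterG`), complexified by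
`exists_rightInverse_chartLog_of_flatH`; `B := max B₀ 0 · (1+2ℓ)(1+2ℓ+2ℓL)`, `ℓ = 6L`.
[cite: Balaban1985Variational, Prop. 3 p.289, (45)-(49) p.285, (55) (57) p.286, (59)-(62) p.287, (73) p.289; Balaban1984PropagatorsII, Cor. 2.8 (2.150)-(2.151) p.249;
Balaban1987RG1, (0.1) p.251] -/
theorem exists_prop3_T4 (F : T4Family) :
    ∃ (Mh₀ R₀ : ℕ) (B : ℝ), 0 ≤ B ∧
    ∀ (n K : ℕ) (_ : 1 ≤ K - n) (_ : K - n + 1 ≤ F.m + K) {Mh R a' : ℕ} (_ : Mh = F.L ^ a') (_ : Mh₀ ≤ Mh) (_ : R₀ ≤ R) (_ : 2 * F.L ≤ R)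
      (_ : a' + 3 ≤ F.m + n) (D : Domains (F.P K)) (_ : D.k = K - n) (_ : Adm22 D R (F.L * Mh))
      (w : ℕ → PBond (F.P K) 0 → ℝ) (_ : IsLevWeight (F.P K) (K - n) D w) {ε : ℝ} (_ : 0 < ε)
      (_ : 18 * (960 * ((((F.P K).d + 2) * (F.P K).L : ℕ) : ℝ) * ((F.P K).L : ℝ) / (12800 * ((((F.P K).d + 2) * (F.P K).L : ℕ) : ℝ) ^ 2 * ((F.P K).L : ℝ))⁻¹) *
        B * ε ≤ 1)
      (_ : 64 * ε ≤ (12800 * ((((F.P K).d + 2) * (F.P K).L : ℕ) : ℝ) ^ 2 * ((F.P K).L : ℝ))⁻¹),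
      let η : ℝ := (((F.P K).L : ℝ)⁻¹) ^ (K - n)
      let Rs : ℝ := (12800 * ((((F.P K).d + 2) * (F.P K).L : ℕ) : ℝ) ^ 2 * ((F.P K).L : ℝ))⁻¹
      let C₂ : ℝ := 960 * ((((F.P K).d + 2) * (F.P K).L : ℕ) : ℝ) * ((F.P K).L : ℝ) / Rs
      let C₃ : ℝ := 3840 * ((((F.P K).d + 2) * (F.P K).L : ℕ) : ℝ) * ((F.P K).L : ℝ) / Rs
      let Qlin := (fderiv ℂ (chartLog η D : (PBond (F.P K) 0 → Matrix ι ι ℂ) → BondIdx D → Matrix ι ι ℂ) 0)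
      ∃ (H : (BondIdx D → Matrix ι ι ℂ) →ₗ[ℂ] (PBond (F.P K) 0 → Matrix ι ι ℂ))
        (Dfun : (PBond (F.P K) 0 → Matrix ι ι ℂ) → (BondIdx D → Matrix ι ι ℂ)),
        (∀ X, Qlin (H X) = X) ∧
        (∀ (X : BondIdx D → Matrix ι ι ℂ) (t : ℝ), 0 ≤ t → (∀ i, ‖X i‖ ≤ t) → ∀ b, w 1 b * ‖H X b‖ ≤ B * t) ∧
        DifferentiableOn ℂ Dfun {A' : PBond (F.P K) 0 → Matrix ι ι ℂ | ∀ b, w 1 b * ‖A' b‖ < ε} ∧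
        (∀ A' : PBond (F.P K) 0 → Matrix ι ι ℂ, (∀ b, w 1 b * ‖A' b‖ < ε) →
          (∀ (ρ : ℝ), 0 ≤ ρ → (∀ b, w 1 b * ‖A' b‖ ≤ ρ) → ∀ i, ‖Dfun A' i‖ ≤ 4 * C₂ * ρ ^ 2) ∧
          chartLog η D (A' - H (Dfun A')) - Qlin (A' - H (Dfun A')) = Dfun A' ∧
          chartLog η D (A' - H (Dfun A')) = Qlin A' ∧
          (∃ 𝔇 : (PBond (F.P K) 0 → Matrix ι ι ℂ) →L[ℂ] (BondIdx D → Matrix ι ι ℂ), HasFDerivAt Dfun 𝔇 A' ∧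
            ∀ (W : PBond (F.P K) 0 → Matrix ι ι ℂ) (t : ℝ), 0 ≤ t → (∀ b, w 1 b * ‖W b‖ ≤ t) → ∀ i, ‖𝔇 W i‖ ≤ 4 * C₃ * ε * t) ∧
          (∀ (ρ : ℝ), 0 ≤ ρ → (∀ b, w 1 b * ‖A' b‖ ≤ ρ) → ∀ b, w 1 b * ‖(A' - H (Dfun A')) b‖ ≤ ρ + B * (4 * C₂ * ρ ^ 2))) ∧
        (∀ A : PBond (F.P K) 0 → Matrix ι ι ℂ, (∀ b, w 1 b * ‖A b‖ < ε / 2) →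
          (∀ b, w 1 b * ‖(A + H (chartLog η D A - Qlin A)) b‖ < ε) ∧
          Dfun (A + H (chartLog η D A - Qlin A)) = chartLog η D A - Qlin A ∧
          (A + H (chartLog η D A - Qlin A)) - H (Dfun (A + H (chartLog η D A - Qlin A))) = A) := by
  obtain ⟨Mh₀, R₀, B₀, δ₀, B₃, -, -, hbody⟩ := body_of_adm22_T4 F
  -- the (46) constant, made non-negative and inflated by the complexification factor (spelled at `F.P 0`; `(F.P K).d`, `(F.P K).L` do not depend on `K`)
  refine ⟨Mh₀, R₀, max B₀ 0 * ((1 + 2 * (((F.P 0).d + 2) * (F.P 0).L : ℕ)) *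
    (1 + 2 * (((F.P 0).d + 2) * (F.P 0).L : ℕ) + 2 * (((F.P 0).d + 2) * (F.P 0).L : ℕ) * (F.P 0).L)), by positivity, ?_⟩
  intro n K hk1 hk' Mh R a' hMha hMh hR h2L hsize D hDk hAdm w hw ε hε h18 h64
  obtain ⟨H₀, Gt, hH₀, -, hsup, -⟩ := hbody n K hk1 hk' hMha hMh hR hsize D hDk hAdm w hw
  have hM1 : 1 ≤ F.L * Mh := by
    have hL := F.hL.2
    rw [hMha]; exact Nat.one_le_iff_ne_zero.mpr (Nat.mul_ne_zero (by omega) (pow_ne_zero _ (by omega)))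
  have h2L' : 2 * (F.P K).L ≤ R := h2L
  exact exists_prop3Package_of_flatH (ι := ι) (K - n) h2L' hM1 D hDk hAdm hw H₀ hH₀ (le_max_right _ _)
    (hSupLetterG_mono hsup (le_max_left _ _)) hε h18 h64

/-- ★★ **[15] PROPOSITION 3 AT THE RECORD WITH ONE `ε₃ > 0` FOR ALL STEPS** («with ε₃ sufficiently small», independent of `k` and of the approximation `K`): as
`exists_prop3_T4`, the window being DISCHARGED — `ε` is produced once for the family `F` (it depends on `L` and the uniform constant `B` only), and the package holds at
this `ε` for every `n, K, D, w` of the record.  (A6 for `exists_prop3_T4`: its `ε`-binders are inhabited, uniformly.)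
[cite: Balaban1985Variational, Prop. 3 p.289, (43) p.285, (54) p.286; Balaban1984PropagatorsII, Cor. 2.8 p.249] -/
theorem exists_prop3_T4_uniform (F : T4Family) :
    ∃ (Mh₀ R₀ : ℕ) (B ε : ℝ), 0 ≤ B ∧ 0 < ε ∧
    ∀ (n K : ℕ) (_ : 1 ≤ K - n) (_ : K - n + 1 ≤ F.m + K) {Mh R a' : ℕ} (_ : Mh = F.L ^ a') (_ : Mh₀ ≤ Mh) (_ : R₀ ≤ R) (_ : 2 * F.L ≤ R)
      (_ : a' + 3 ≤ F.m + n) (D : Domains (F.P K)) (_ : D.k = K - n) (_ : Adm22 D R (F.L * Mh))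
      (w : ℕ → PBond (F.P K) 0 → ℝ) (_ : IsLevWeight (F.P K) (K - n) D w),
      let η : ℝ := (((F.P K).L : ℝ)⁻¹) ^ (K - n)
      let Rs : ℝ := (12800 * ((((F.P K).d + 2) * (F.P K).L : ℕ) : ℝ) ^ 2 * ((F.P K).L : ℝ))⁻¹
      let C₂ : ℝ := 960 * ((((F.P K).d + 2) * (F.P K).L : ℕ) : ℝ) * ((F.P K).L : ℝ) / Rs
      let C₃ : ℝ := 3840 * ((((F.P K).d + 2) * (F.P K).L : ℕ) : ℝ) * ((F.P K).L : ℝ) / Rs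
      let Qlin := (fderiv ℂ (chartLog η D : (PBond (F.P K) 0 → Matrix ι ι ℂ) → BondIdx D → Matrix ι ι ℂ) 0)
      64 * ε ≤ Rs ∧
      ∃ (H : (BondIdx D → Matrix ι ι ℂ) →ₗ[ℂ] (PBond (F.P K) 0 → Matrix ι ι ℂ))
        (Dfun : (PBond (F.P K) 0 → Matrix ι ι ℂ) → (BondIdx D → Matrix ι ι ℂ)),
        (∀ X, Qlin (H X) = X) ∧
        (∀ (X : BondIdx D → Matrix ι ι ℂ) (t : ℝ), 0 ≤ t → (∀ i, ‖X i‖ ≤ t) → ∀ b, w 1 b * ‖H X b‖ ≤ B * t) ∧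
        DifferentiableOn ℂ Dfun {A' : PBond (F.P K) 0 → Matrix ι ι ℂ | ∀ b, w 1 b * ‖A' b‖ < ε} ∧
        (∀ A' : PBond (F.P K) 0 → Matrix ι ι ℂ, (∀ b, w 1 b * ‖A' b‖ < ε) →
          (∀ (ρ : ℝ), 0 ≤ ρ → (∀ b, w 1 b * ‖A' b‖ ≤ ρ) → ∀ i, ‖Dfun A' i‖ ≤ 4 * C₂ * ρ ^ 2) ∧
          chartLog η D (A' - H (Dfun A')) - Qlin (A' - H (Dfun A')) = Dfun A' ∧
          chartLog η D (A' - H (Dfun A')) = Qlin A' ∧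
          (∃ 𝔇 : (PBond (F.P K) 0 → Matrix ι ι ℂ) →L[ℂ] (BondIdx D → Matrix ι ι ℂ), HasFDerivAt Dfun 𝔇 A' ∧
            ∀ (W : PBond (F.P K) 0 → Matrix ι ι ℂ) (t : ℝ), 0 ≤ t → (∀ b, w 1 b * ‖W b‖ ≤ t) → ∀ i, ‖𝔇 W i‖ ≤ 4 * C₃ * ε * t) ∧
          (∀ (ρ : ℝ), 0 ≤ ρ → (∀ b, w 1 b * ‖A' b‖ ≤ ρ) → ∀ b, w 1 b * ‖(A' - H (Dfun A')) b‖ ≤ ρ + B * (4 * C₂ * ρ ^ 2))) ∧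
        (∀ A : PBond (F.P K) 0 → Matrix ι ι ℂ, (∀ b, w 1 b * ‖A b‖ < ε / 2) →
          (∀ b, w 1 b * ‖(A + H (chartLog η D A - Qlin A)) b‖ < ε) ∧
          Dfun (A + H (chartLog η D A - Qlin A)) = chartLog η D A - Qlin A ∧
          (A + H (chartLog η D A - Qlin A)) - H (Dfun (A + H (chartLog η D A - Qlin A))) = A) := by
  obtain ⟨Mh₀, R₀, B, hB, hmain⟩ := exists_prop3_T4 (ι := ι) F
  -- the letters at `F.P 0` (they do not depend on `K`)
  have hL0 : (0 : ℝ) < (F.P 0).L := by exact_mod_cast (F.P 0).L_pos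
  have hden : 0 < 12800 * ((((F.P 0).d + 2) * (F.P 0).L : ℕ) : ℝ) ^ 2 * ((F.P 0).L : ℝ) := by
    have : (1 : ℝ) ≤ ((((F.P 0).d + 2) * (F.P 0).L : ℕ) : ℝ) := by
      exact_mod_cast Nat.one_le_iff_ne_zero.mpr (Nat.mul_ne_zero (by omega) (by have := (F.P 0).hL.2; omega))
    positivity
  have hC₂ : 0 ≤ 960 * ((((F.P 0).d + 2) * (F.P 0).L : ℕ) : ℝ) * ((F.P 0).L : ℝ) /
      (12800 * ((((F.P 0).d + 2) * (F.P 0).L : ℕ) : ℝ) ^ 2 * ((F.P 0).L : ℝ))⁻¹ := by positivity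
  obtain ⟨ε, hε, h18, h64⟩ := exists_eps_chartDDeriv hC₂ hB (inv_pos.mpr hden)
  refine ⟨Mh₀, R₀, B, ε, hB, hε, ?_⟩
  intro n K hk1 hk' Mh R a' hMha hMh hR h2L hsize D hDk hAdm w hw
  exact ⟨h64, hmain n K hk1 hk' hMha hMh hR h2L hsize D hDk hAdm w hw hε h18 h64⟩

end Summit.QuantumFields.YangMills.BalabanUVNodes.N07Prop3AtRecord

end
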